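import Summits.QuantumFields.YangMills.Theorems.SwapVirialDeficitZeroModeSigmaFourSmallBallScaling
import HarnessLib

/-!
# Exact zero-mode rung Z5 — the σ-TWISTED FOUR-LEADER small ball, III-a: thresholds, letter paths and their `t`-derivatives
# (LEAD ym-line-sfw-p2 g93 07:46Z «`Haar⁴{E_σ(t)} = v₇t⁷(1 + O(t^θ))`»; free-hands support of ⟨stmt-QuantumFields-24197⟩)

The pointwise limit of the rescaled σ-events.  Two devices keep the algebra small:
* THRESHOLD DECOUPLED FROM SCALE (§23): `rescaledSigmaR r s A = (dil3 s)⁻¹(transSet (r·s) A ∩ B³)` — relations at tolerance `r·s`, blow-up at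
  scale `s`; ★ `haar_sigmaBall_eq_scaledR : Haar⁴(E_σ(r s)) = s⁷·coneConst³·∫ vol³(rescaledSigmaR r s A(a)) dcone(a)` (same proof as part II), and
  `rescaledSigmaR r s A ⊆ rescaledSigma s A` for `r ≤ 1` (so part IV's dominator applies).  Part V takes the limit along `s = t/r` for a
  threshold `r ∈ (0, 1]` whose level sets `{‖L_i‖ = r}` are null — all but countably many — so no boundary geometry is ever computed.
* THE SIX RELATIONS AS SMOOTH PATHS (§24–§26): in the blown-up coordinates the four unit letters are `X(s) = ν(x̄ + s·x_⊥)`, `Y(s) = ν(ȳ + s·y_⊥)`,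
  `Z(s) = ν(z₀ + s·ζ)`, `A` (`ν = radialUnit`, ✓`Literature.Analysis.Calculus.RadialCalculus.hasFDerivAt_radialUnit`), the slaved letter is
  `W(s) = (Ā X(s) A)·Z(s)`, and the six relations read `‖M_i(s)‖ ≤ r·s` for six products `M_i` of these paths (`mem_rescaledSigmaR_iff`).  Each `M_i`
  is differentiable at `s = 0` with an EXPLICIT derivative `L_i` (product rule, `hasDerivAt_M₁…₆`) and vanishes at `s = 0` when `z₀ > 0`
  (`M_zero_of_pos`; axial letters commute), so `‖M_i(s)‖ ≤ r s` becomes `‖s⁻¹M_i(s)‖ ≤ r → ‖L_i‖ ≤ r` (part III-b).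
HONEST LABEL: finite-dimensional calculus on `SU(2)⁴` (plan-level zero-mode rung of the DRAFT line «sharp-sigma»); NOT the fixed-`L` sharp law,
NOT ⟨24197⟩; own crux ⟨22884⟩ OPEN (blocked-on ⟨19935⟩); the Yang–Mills mass gap is NOT proved; no summit is proved by a line.
Width seat ym-line-sfw-p2-w3 g63 (cell ym-idea-1, free hands), `--supports stmt-QuantumFields-24197`.  Standard axioms, 0 `sorry`.
References: [cite: GonzalezarroyoAltes1988]; [cite: Vanbaal2001]; [cite: Luscher1983, §2]; [folklore].
-/

set_option autoImplicit false

noncomputable section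

open MeasureTheory Quaternion Set Filter Topology
open scoped Quaternion ENNReal BigOperators RealInnerProductSpace
open Literature.MathematicalPhysics.QuantumLattice
open Literature.MathematicalPhysics.QuantumFieldTheory (haarProbability)
open Literature.Analysis.Calculus (radialUnit radialUnit_def norm_radialUnit tangentialProj tangentialProj_apply hasFDerivAt_radialUnit)
open Summit.QuantumFields.YangMills.Theorems.SwapTwistDeficit.ToronLog
open Summit.QuantumFields.YangMills.Theorems.SwapVirialDeficit.ZeroModeGroup

attribute [local instance] Literature.Analysis.FluidPDE.Tao2016.quatMeasurableSpace
  Literature.Analysis.FluidPDE.Tao2016.quatBorelSpace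
  Literature.MathematicalPhysics.QuantumLattice.secondCountableTopology_su2

namespace Summit.QuantumFields.YangMills.Theorems.SwapVirialDeficit.ZeroModeSigma

/-! ## §23 Threshold decoupled from scale -/

/-- The rescaled σ-event with tolerance `r·s` at blow-up scale `s`. [folklore] -/
def rescaledSigmaR (r s : ℝ) (A : ℍ) : Set ((ℍ × ℍ) × ℍ) := (dil3 s) ⁻¹' (transSet (r * s) A ∩ ball3)

/-- Unfolding `rescaledSigmaR`. [folklore] -/
theorem rescaledSigmaR_def (r s : ℝ) (A : ℍ) : rescaledSigmaR r s A = (dil3 s) ⁻¹' (transSet (r * s) A ∩ ball3) := rfl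

/-- At `r = 1` this is part II's event. [folklore] -/
theorem rescaledSigmaR_one (s : ℝ) (A : ℍ) : rescaledSigmaR 1 s A = rescaledSigma s A := by
  rw [rescaledSigmaR, one_mul, rescaledSigma_def]

/-- `sigmaSet` is monotone in the tolerance. [folklore] -/
theorem sigmaSet_mono {t t' : ℝ} (h : t ≤ t') : sigmaSet t ⊆ sigmaSet t' := by
  intro q hq
  obtain ⟨h1, h2, h3, h4, h5, h6⟩ := hq
  exact ⟨h1.trans h, h2.trans h, h3.trans h, h4.trans h, h5.trans h, h6.trans h⟩

/-- For `r ≤ 1`, `s ≥ 0`: `rescaledSigmaR r s A ⊆ rescaledSigma s A` (so part IV's dominator applies). [folklore] -/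
theorem rescaledSigmaR_subset {r s : ℝ} (hr : r ≤ 1) (hs : 0 ≤ s) (A : ℍ) : rescaledSigmaR r s A ⊆ rescaledSigma s A := by
  intro w hw
  rw [rescaledSigmaR, Set.mem_preimage, Set.mem_inter_iff, mem_transSet_iff] at hw
  rw [rescaledSigma_def, Set.mem_preimage, Set.mem_inter_iff, mem_transSet_iff]
  have hle : r * s ≤ s := by nlinarith
  exact ⟨sigmaSet_mono hle hw.1, hw.2⟩

/-- `rescaledSigmaR r s A` is measurable. [folklore] -/
theorem measurableSet_rescaledSigmaR (r s : ℝ) (A : ℍ) : MeasurableSet (rescaledSigmaR r s A) :=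
  ((measurableSet_transSet _ A).inter measurableSet_ball3).preimage (measurable_dil3 s)

/-- The exact Jacobian at scale `s`: `vol³(transSet (r s) A ∩ B³) = s⁷·vol³(rescaledSigmaR r s A)` (`s > 0`). [folklore] -/
theorem volume_transSet_inter_ball3_R (r : ℝ) {s : ℝ} (hs : 0 < s) (A : ℍ) :
    volume (transSet (r * s) A ∩ ball3) = ENNReal.ofReal (s ^ 7) * volume (rescaledSigmaR r s A) := by
  haveI := isAddHaarMeasure_volume3
  have hdet : LinearMap.det (dil3 s) ≠ 0 := by rw [det_dil3]; positivity
  have h7 : 0 < s ^ 7 := by positivity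
  rw [rescaledSigmaR, Measure.addHaar_preimage_linearMap (μ := (volume : Measure ((ℍ × ℍ) × ℍ))) hdet, det_dil3, abs_inv,
    abs_of_pos h7, ← mul_assoc, ← ENNReal.ofReal_mul h7.le, mul_inv_cancel₀ h7.ne', ENNReal.ofReal_one, one_mul]

/-- The hub integrand `a ↦ vol³(rescaledSigmaR r s A(a))` is measurable. [folklore] -/
theorem measurable_volume_rescaledSigmaR (r s : ℝ) : Measurable fun a : ℍ => volume (rescaledSigmaR r s (radialUnit (axisPoint a))) := by
  have hA : Measurable fun q : ℍ × ((ℍ × ℍ) × ℍ) => radialUnit (axisPoint q.1) := measurable_axisUnit.comp measurable_fst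
  have hD : Measurable fun q : ℍ × ((ℍ × ℍ) × ℍ) => dil3 s q.2 := (measurable_dil3 s).comp measurable_snd
  have hx : Measurable fun q : ℍ × ((ℍ × ℍ) × ℍ) => (dil3 s q.2).1.1 := measurable_fst.comp (measurable_fst.comp hD)
  have hy : Measurable fun q : ℍ × ((ℍ × ℍ) × ℍ) => (dil3 s q.2).1.2 := measurable_snd.comp (measurable_fst.comp hD)
  have hz : Measurable fun q : ℍ × ((ℍ × ℍ) × ℍ) => (dil3 s q.2).2 := measurable_snd.comp hD
  have hJ : MeasurableSet ({q : ℍ × ((ℍ × ℍ) × ℍ) |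
      (radialUnit (dil3 s q.2).1.1, slaveP (radialUnit (axisPoint q.1)) (dil3 s q.2).1.1 * radialUnit (dil3 s q.2).2,
        radialUnit (dil3 s q.2).1.2, radialUnit (axisPoint q.1)) ∈ sigmaSet (r * s)} ∩ {q | dil3 s q.2 ∈ ball3}) :=
    (measurableSet_preimage_sigmaSet _ (measurable_radialUnit.comp hx) ((measurable_slaveP.comp (hA.prodMk hx)).mul (measurable_radialUnit.comp hz))
      (measurable_radialUnit.comp hy) hA).inter (measurableSet_ball3.preimage hD)
  have hsec : ∀ a : ℍ, Prod.mk a ⁻¹' ({q : ℍ × ((ℍ × ℍ) × ℍ) |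
      (radialUnit (dil3 s q.2).1.1, slaveP (radialUnit (axisPoint q.1)) (dil3 s q.2).1.1 * radialUnit (dil3 s q.2).2,
        radialUnit (dil3 s q.2).1.2, radialUnit (axisPoint q.1)) ∈ sigmaSet (r * s)} ∩ {q | dil3 s q.2 ∈ ball3}) =
      rescaledSigmaR r s (radialUnit (axisPoint a)) := by
    intro a; ext w
    simp only [Set.mem_preimage, Set.mem_inter_iff, Set.mem_setOf_eq, rescaledSigmaR, mem_transSet_iff, dil3_apply]
  have h := measurable_measure_prodMk_left (ν := (volume : Measure ((ℍ × ℍ) × ℍ))) hJ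
  simp only [hsec] at h
  exact h

/-- ★ **The exact `s⁷` with decoupled threshold**: `Haar⁴(E_σ(r·s)) = s⁷·coneConst³·∫ vol³(rescaledSigmaR r s A(a)) dcone(a)` (`s > 0`, `r ≥ 0`).
[folklore] -/
theorem haar_sigmaBall_eq_scaledR {r s : ℝ} (hr : 0 ≤ r) (hs : 0 < s) :
    (Measure.pi fun _ : Fin 4 => haarProbability (Matrix.specialUnitaryGroup (Fin 2) ℂ)) (sigmaBall (r * s)) =
      ENNReal.ofReal (s ^ 7) * (ENNReal.ofReal coneConst ^ 3 * ∫⁻ a, volume (rescaledSigmaR r s (radialUnit (axisPoint a))) ∂coneMeasure) := by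
  have hm := measurable_volume_rescaledSigmaR r s
  rw [haar_sigmaBall_eq_lintegral (by positivity : 0 ≤ r * s)]
  have e : ∀ a : ℍ, coneThree (transSet (r * s) (radialUnit (axisPoint a))) =
      ENNReal.ofReal (s ^ 7) * (ENNReal.ofReal coneConst ^ 3 * volume (rescaledSigmaR r s (radialUnit (axisPoint a)))) := by
    intro a
    rw [coneThree_apply (measurableSet_transSet _ _), volume_transSet_inter_ball3_R r hs, ← mul_assoc, ← mul_assoc,
      mul_comm (ENNReal.ofReal coneConst ^ 3)]
  simp only [e]
  rw [lintegral_const_mul _ (hm.const_mul _), lintegral_const_mul _ hm]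

/-! ## §24 The letter paths of the blow-up -/

/-- Axial part `x̄ = (x₀, x_I, 0, 0)` of a pair letter. [folklore] -/
def axPart (x : ℍ) : ℍ := ⟨x.re, x.imI, 0, 0⟩

/-- Transversal part `x_⊥ = (0, 0, x_J, x_K)` of a pair letter. [folklore] -/
def trPart (x : ℍ) : ℍ := ⟨0, 0, x.imJ, x.imK⟩

/-- `D_s x = x̄ + s·x_⊥`. [folklore] -/
theorem dilate_eq_axPart_add (s : ℝ) (x : ℍ) : dilate s x = axPart x + s • trPart x := by
  rw [dilate_apply]; ext <;> simp [axPart, trPart]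

/-- `D³_s z = z₀ + s·Im z`. [folklore] -/
theorem dilateIm_eq_re_add (s : ℝ) (z : ℍ) : dilateIm s z = (z.re : ℍ) + s • z.im := by
  rw [dilateIm_apply]; ext <;> simp

/-- The pair-letter path `X(s) = ν(x̄ + s·x_⊥)`. [folklore] -/
def Xp (x : ℍ) (s : ℝ) : ℍ := radialUnit (axPart x + s • trPart x)

/-- The slaved-letter path `Z(s) = ν(z₀ + s·ζ)`. [folklore] -/
def Zp (z : ℍ) (s : ℝ) : ℍ := radialUnit ((z.re : ℍ) + s • z.im)

/-- The slaved letter itself `W(s) = (Ā X(s) A)·Z(s)`. [folklore] -/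
def Wp (A x z : ℍ) (s : ℝ) : ℍ := (star A * Xp x s * A) * Zp z s

/-- `X(s) = radialUnit (D_s x)`. [folklore] -/
theorem Xp_eq (x : ℍ) (s : ℝ) : Xp x s = radialUnit (dilate s x) := by rw [Xp, dilate_eq_axPart_add]

/-- `Z(s) = radialUnit (D³_s z)`. [folklore] -/
theorem Zp_eq (z : ℍ) (s : ℝ) : Zp z s = radialUnit (dilateIm s z) := by rw [Zp, dilateIm_eq_re_add]

/-- `W(s) = slaveP A (D_s x) · radialUnit (D³_s z)`. [folklore] -/
theorem Wp_eq (A x z : ℍ) (s : ℝ) : Wp A x z s = slaveP A (dilate s x) * radialUnit (dilateIm s z) := by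
  rw [Wp, slaveP_def, Xp_eq, Zp_eq]

/-- `X(0) = ν(x̄)`. [folklore] -/
theorem Xp_zero (x : ℍ) : Xp x 0 = radialUnit (axPart x) := by rw [Xp, zero_smul, add_zero]

/-- `Z(0) = ν(z₀)`. [folklore] -/
theorem Zp_zero (z : ℍ) : Zp z 0 = radialUnit (z.re : ℍ) := by rw [Zp, zero_smul, add_zero]

/-- `ν(z₀) = 1` for `z₀ > 0`. [folklore] -/
theorem radialUnit_coe_of_pos {c : ℝ} (hc : 0 < c) : radialUnit (c : ℍ) = 1 := by
  rw [radialUnit_def, Quaternion.norm_coe, Real.norm_eq_abs, abs_of_pos hc, ← Quaternion.coe_smul, smul_eq_mul, inv_mul_cancel₀ hc.ne',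
    Quaternion.coe_one]

/-- `ν(z₀) = −1` for `z₀ < 0`. [folklore] -/
theorem radialUnit_coe_of_neg {c : ℝ} (hc : c < 0) : radialUnit (c : ℍ) = -1 := by
  rw [radialUnit_def, Quaternion.norm_coe, Real.norm_eq_abs, abs_of_neg hc, ← Quaternion.coe_smul, smul_eq_mul, ← Quaternion.coe_one,
    ← Quaternion.coe_neg]
  congr 1
  rw [← neg_inv, neg_mul, inv_mul_cancel₀ hc.ne]

/-- `W(0) = (Ā ν(x̄) A)·ν(z₀)`. [folklore] -/
theorem Wp_zero (A x z : ℍ) : Wp A x z 0 = star A * radialUnit (axPart x) * A * radialUnit (z.re : ℍ) := by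
  rw [Wp, Xp_zero, Zp_zero]

/-! ## §25 Derivatives of the letter paths at `s = 0` -/

/-- The derivative of `X` at `0`: `X'(0) = P_{x̄}(x_⊥)/‖x̄‖` (✓`hasFDerivAt_radialUnit`). [folklore] -/
def Xd (x : ℍ) : ℍ := (‖axPart x‖⁻¹ • tangentialProj (axPart x)) (trPart x)

/-- The derivative of `Z` at `0`: `Z'(0) = P_{z₀}(ζ)/|z₀|`. [folklore] -/
def Zd (z : ℍ) : ℍ := (‖(z.re : ℍ)‖⁻¹ • tangentialProj (z.re : ℍ)) z.im

/-- The derivative of `W` at `0` (product rule). [folklore] -/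
def Wd (A x z : ℍ) : ℍ := star A * Xd x * A * radialUnit (z.re : ℍ) + star A * radialUnit (axPart x) * A * Zd z

/-- ★ `X` is differentiable at `0` with derivative `Xd x` (`x̄ ≠ 0`). [folklore] -/
theorem hasDerivAt_Xp {x : ℍ} (hx : axPart x ≠ 0) : HasDerivAt (Xp x) (Xd x) 0 := by
  have hpath : HasDerivAt (fun s : ℝ => axPart x + s • trPart x) (trPart x) 0 := by
    simpa using ((hasDerivAt_id (0:ℝ)).smul_const (trPart x)).const_add (axPart x)
  have h0 : axPart x + (0:ℝ) • trPart x = axPart x := by rw [zero_smul, add_zero]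
  have hF : HasFDerivAt (radialUnit (E := ℍ)) (‖axPart x‖⁻¹ • tangentialProj (axPart x)) (axPart x + (0:ℝ) • trPart x) := by
    rw [h0]; exact hasFDerivAt_radialUnit hx
  exact hF.comp_hasDerivAt (0:ℝ) hpath

/-- ★ `Z` is differentiable at `0` with derivative `Zd z` (`z₀ ≠ 0`). [folklore] -/
theorem hasDerivAt_Zp {z : ℍ} (hz : z.re ≠ 0) : HasDerivAt (Zp z) (Zd z) 0 := by
  have hpath : HasDerivAt (fun s : ℝ => (z.re : ℍ) + s • z.im) z.im 0 := by
    simpa using ((hasDerivAt_id (0:ℝ)).smul_const z.im).const_add (z.re : ℍ)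
  have h0 : (z.re : ℍ) + (0:ℝ) • z.im = (z.re : ℍ) := by rw [zero_smul, add_zero]
  have hne : (z.re : ℍ) ≠ 0 := by rwa [Ne, ← Quaternion.coe_zero, Quaternion.coe_inj]
  have hF : HasFDerivAt (radialUnit (E := ℍ)) (‖(z.re : ℍ)‖⁻¹ • tangentialProj (z.re : ℍ)) ((z.re : ℍ) + (0:ℝ) • z.im) := by
    rw [h0]; exact hasFDerivAt_radialUnit hne
  exact hF.comp_hasDerivAt (0:ℝ) hpath

/-- ★ `W` is differentiable at `0` with derivative `Wd A x z` (`x̄ ≠ 0`, `z₀ ≠ 0`). [folklore] -/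
theorem hasDerivAt_Wp (A : ℍ) {x z : ℍ} (hx : axPart x ≠ 0) (hz : z.re ≠ 0) : HasDerivAt (Wp A x z) (Wd A x z) 0 := by
  have hP : HasDerivAt (fun s => star A * Xp x s * A) (star A * Xd x * A) 0 := ((hasDerivAt_Xp hx).const_mul (star A)).mul_const A
  have h := hP.mul (hasDerivAt_Zp hz)
  have e : (fun s => star A * Xp x s * A) * Zp z = Wp A x z := by funext s; rfl
  rw [e] at h
  refine h.congr_deriv ?_
  rw [Wd, Zp_zero, Xp_zero]

/-! ## §26 The six relation maps and their derivatives -/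

/-- The six relation maps of the blown-up σ-event as functions of the scale `s` (order: `[X,W]`, `[X,Y]`, `[W,Y]`, `AW − XA`, `AX − WA`, `AY − YA`).
[folklore] -/
def Mrel (A x y z : ℍ) (i : Fin 6) (s : ℝ) : ℍ :=
  match i with
  | 0 => Xp x s * Wp A x z s - Wp A x z s * Xp x s
  | 1 => Xp x s * Xp y s - Xp y s * Xp x s
  | 2 => Wp A x z s * Xp y s - Xp y s * Wp A x z s
  | 3 => A * Wp A x z s - Xp x s * A
  | 4 => A * Xp x s - Wp A x z s * A
  | 5 => A * Xp y s - Xp y s * A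

/-- Their derivatives at `s = 0` (product rule; `ux = ν(x̄)`, `uy = ν(ȳ)`, `W₀ = W(0)`). [folklore] -/
def Lrel (A x y z : ℍ) (i : Fin 6) : ℍ :=
  match i with
  | 0 => Xd x * Wp A x z 0 + Xp x 0 * Wd A x z - (Wd A x z * Xp x 0 + Wp A x z 0 * Xd x)
  | 1 => Xd x * Xp y 0 + Xp x 0 * Xd y - (Xd y * Xp x 0 + Xp y 0 * Xd x)
  | 2 => Wd A x z * Xp y 0 + Wp A x z 0 * Xd y - (Xd y * Wp A x z 0 + Xp y 0 * Wd A x z)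
  | 3 => A * Wd A x z - Xd x * A
  | 4 => A * Xd x - Wd A x z * A
  | 5 => A * Xd y - Xd y * A

/-- ★ **Each relation map is differentiable at `s = 0` with derivative `Lrel`** (`x̄, ȳ ≠ 0`, `z₀ ≠ 0`). [folklore] -/
theorem hasDerivAt_Mrel (A : ℍ) {x y z : ℍ} (hx : axPart x ≠ 0) (hy : axPart y ≠ 0) (hz : z.re ≠ 0) (i : Fin 6) :
    HasDerivAt (Mrel A x y z i) (Lrel A x y z i) 0 := by
  have hX := hasDerivAt_Xp hx
  have hY := hasDerivAt_Xp hy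
  have hW := hasDerivAt_Wp A hx hz
  have hA : HasDerivAt (fun _ : ℝ => A) 0 0 := hasDerivAt_const 0 A
  match i with
  | 0 =>
    have h := (hX.mul hW).sub (hW.mul hX)
    exact h.congr_deriv rfl
  | 1 =>
    have h := (hX.mul hY).sub (hY.mul hX)
    exact h.congr_deriv rfl
  | 2 =>
    have h := (hW.mul hY).sub (hY.mul hW)
    exact h.congr_deriv rfl
  | 3 =>
    have h := (hW.const_mul A).sub (hX.mul_const A)
    exact h.congr_deriv rfl
  | 4 =>
    have h := (hX.const_mul A).sub (hW.mul_const A)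
    exact h.congr_deriv rfl
  | 5 =>
    have h := (hY.const_mul A).sub (hY.mul_const A)
    exact h.congr_deriv rfl

/-- Two axial quaternions commute. [folklore] -/
theorem axial_comm {a b : ℍ} (haJ : a.imJ = 0) (haK : a.imK = 0) (hbJ : b.imJ = 0) (hbK : b.imK = 0) : a * b = b * a := by
  ext <;> simp [haJ, haK, hbJ, hbK] <;> ring

/-- `ν(x̄)` is axial. [folklore] -/
theorem radialUnit_axPart_axial (x : ℍ) : (radialUnit (axPart x)).imJ = 0 ∧ (radialUnit (axPart x)).imK = 0 := by
  rw [radialUnit_def]; simp [axPart]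

/-- For an axial `A` with `‖A‖ = 1`: `Ā·ν(x̄)·A = ν(x̄)`. [folklore] -/
theorem conj_radialUnit_axPart {A : ℍ} (hA : ‖A‖ = 1) (hJ : A.imJ = 0) (hK : A.imK = 0) (x : ℍ) :
    star A * radialUnit (axPart x) * A = radialUnit (axPart x) := by
  obtain ⟨huJ, huK⟩ := radialUnit_axPart_axial x
  have hAA : star A * A = 1 := by
    rw [Quaternion.star_mul_self, Quaternion.normSq_eq_norm_mul_self, hA, mul_one, Quaternion.coe_one]
  rw [mul_assoc, ← axial_comm hJ hK huJ huK, ← mul_assoc, hAA, one_mul]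

/-- ★ **All six relation maps vanish at `s = 0` when `z₀ > 0`** (axial unit hub `A`): the blown-up letters `ν(x̄), ν(ȳ), A` are axial and commute,
and the slaved letter is `W(0) = Ā ν(x̄) A · 1 = ν(x̄)`. [folklore] -/
theorem Mrel_zero_of_pos {A : ℍ} (hA : ‖A‖ = 1) (hJ : A.imJ = 0) (hK : A.imK = 0) (x y : ℍ) {z : ℍ} (hz : 0 < z.re) (i : Fin 6) :
    Mrel A x y z i 0 = 0 := by
  have hW : Wp A x z 0 = radialUnit (axPart x) := by rw [Wp_zero, radialUnit_coe_of_pos hz, mul_one, conj_radialUnit_axPart hA hJ hK]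
  obtain ⟨hxJ, hxK⟩ := radialUnit_axPart_axial x
  obtain ⟨hyJ, hyK⟩ := radialUnit_axPart_axial y
  match i with
  | 0 => simp only [Mrel, hW, Xp_zero, sub_self]
  | 1 => simp only [Mrel, Xp_zero]; rw [axial_comm hxJ hxK hyJ hyK, sub_self]
  | 2 => simp only [Mrel, hW, Xp_zero]; rw [axial_comm hxJ hxK hyJ hyK, sub_self]
  | 3 => simp only [Mrel, hW, Xp_zero]; rw [axial_comm hJ hK hxJ hxK, sub_self]
  | 4 => simp only [Mrel, hW, Xp_zero]; rw [axial_comm hJ hK hxJ hxK, sub_self]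
  | 5 => simp only [Mrel, Xp_zero]; rw [axial_comm hJ hK hyJ hyK, sub_self]

/-- For `z₀ < 0` the first seam relation map does NOT vanish at `s = 0`: `M₃(0) = −2·ν(x̄)·A`, of norm `2` (`x̄ ≠ 0`). [folklore] -/
theorem norm_Mrel_three_zero_of_neg {A : ℍ} (hA : ‖A‖ = 1) (hJ : A.imJ = 0) (hK : A.imK = 0) {x : ℍ} (hx : axPart x ≠ 0) (y : ℍ) {z : ℍ}
    (hz : z.re < 0) : ‖Mrel A x y z 3 0‖ = 2 := by
  obtain ⟨hxJ, hxK⟩ := radialUnit_axPart_axial x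
  have hW : Wp A x z 0 = -radialUnit (axPart x) := by
    rw [Wp_zero, radialUnit_coe_of_neg hz, mul_neg, mul_one, conj_radialUnit_axPart hA hJ hK]
  simp only [Mrel, hW, Xp_zero]
  have e : A * -radialUnit (axPart x) - radialUnit (axPart x) * A = (-2 : ℝ) • (radialUnit (axPart x) * A) := by
    rw [mul_neg, axial_comm hJ hK hxJ hxK, neg_smul, two_smul, neg_add]
    abel
  rw [e, norm_smul, Real.norm_eq_abs, abs_neg, abs_of_pos (by norm_num : (0:ℝ) < 2), norm_mul, norm_radialUnit hx, hA, mul_one, mul_one]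

/-- ★ **The rescaled event through the relation maps**: for `s > 0`, `((x,y),z) ∈ rescaledSigmaR r s A` iff the dilated letters lie in the unit
balls and `‖M_i(s)‖ ≤ r·s` for the six relation maps. [folklore] -/
theorem mem_rescaledSigmaR_iff (r s : ℝ) (A : ℍ) (w : (ℍ × ℍ) × ℍ) :
    w ∈ rescaledSigmaR r s A ↔ (∀ i : Fin 6, ‖Mrel A w.1.1 w.1.2 w.2 i s‖ ≤ r * s) ∧
      (‖dilate s w.1.1‖ < 1 ∧ ‖dilate s w.1.2‖ < 1) ∧ ‖dilateIm s w.2‖ < 1 := by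
  rw [rescaledSigmaR, Set.mem_preimage, Set.mem_inter_iff, dil3_apply, mem_transSet_iff, mem_ball3_iff, mem_sigmaSet_iff]
  simp only [← Xp_eq, ← Wp_eq]
  constructor
  · rintro ⟨⟨h1, h2, h3, h4, h5, h6⟩, hb⟩
    refine ⟨fun i => ?_, hb⟩
    match i with
    | 0 => exact h1
    | 1 => exact h2
    | 2 => exact h3
    | 3 => exact h4
    | 4 => exact h5
    | 5 => exact h6
  · rintro ⟨h, hb⟩
    exact ⟨⟨h 0, h 1, h 2, h 3, h 4, h 5⟩, hb⟩

end Summit.QuantumFields.YangMills.Theorems.SwapVirialDeficit.ZeroModeSigma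

end
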